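import Summits.CriticalPhenomena.SAWScalingLimit.Theorems.SAWMassiveIsingTiltHexEndpointApproxExistsStray
import Literature.Probability.LatticeModels.MeshDomainJordan
import HarnessLib

/-!
# The largest honeycomb mesh component of a Jordan domain is the bulk (fine-lattice form)

Support file 2/3 for item `stmt-CriticalPhenomena-9864` (`HexEndpointApproxExists`). Setting as in
`…Stray.lean`: `G_N = (triMeshGraph Ω δ).induce N`, `N` the non-centre mesh vertices of the fine
triangular lattice (= honeycomb vertices, `HexMeshCoord.lean`), `Ω' = triLinear ⁻¹' Ω`.
* `GN_reachable_of_mem_bulk` — non-centre sites with mesh points in a preconnected `V` at distance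
  `> ρ ≥ 5δ` from `Ω'ᶜ` are joined in `G_N` (square-mesh reachability in the sheared punctured
  domain `Ω⋆'` of `HexMeshHexagon.lean`, re-routed by `HexMesh.GN_reachable_of_punct_reachable`).
* `exists_hexBulk` — for a Jordan domain and a compact `K ⊆ D.carrier`, for small `δ`
  one component of `G_N` contains every vertex with mesh point in `K` and every other component is
  strictly smaller: the bulk has `≥ 3 area(Ω')/(8 δ² v)` vertices (`#P ≤ 2 #Q` by translating
  centre sites by `e₀`), a stray component has horizontal extent `< D₀ = area/(64 R v)`
  (`JordanDomain.mul_sub_lt_of_hexStray`), hence `≤ 15 D₀ R/δ²` vertices. Port of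
  `TriMeshTriJordan.lean`. Folklore.
-/

noncomputable section

open Set Metric MeasureTheory
open Literature.Probability.LatticeModels Literature.Probability.LatticeModels.TriMesh
open Literature.Probability.LatticeModels.HexMesh Literature.Probability.RandomPlanarGeometry

namespace Summit.CriticalPhenomena.SAWScalingLimit.Theorems.HexEndpointApprox

variable {N : Set (Site 2)}

/-! ### All non-centre lattice points of the bulk lie in one component of `G_N` -/

/-- **One component (honeycomb).** If `V` is preconnected and every point of `V` is at distance
`> ρ ≥ 5δ` from `Ω'ᶜ` (`Ω' = triLinear ⁻¹' Ω`, open bounded `Ω`), then any two non-centre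
sites whose (square) mesh points lie in `V` are joined in the honeycomb mesh graph `G_N`. Proof:
the punctured domain `Ω⋆` of `HexMeshHexagon.lean` contains the balls `B(w, ρ - 2δ)`, `w ∈ V`
(punctures are within `3δ/2` of `Ω'ᶜ`), so the two sites are joined in the square mesh graph of
the sheared punctured domain (`meshVertexGraph_reachable_of_mem_bulk`), hence in its triangular
mesh graph, hence in `G_N` (`HexMesh.GN_reachable_of_punct_reachable`). [folklore] -/
theorem GN_reachable_of_mem_bulk {Ω : Set ℂ} (hΩo : IsOpen Ω) (hΩb : Bornology.IsBounded Ω)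
    {δ ρ : ℝ} (hδ : 0 < δ) (hδρ : 5 * δ ≤ ρ) {V : Set ℂ} (hV : IsPreconnected V)
    (hVρ : ∀ w ∈ V, ρ < infDist w (triLinear ⁻¹' Ω)ᶜ)
    (hN : N = {x : Site 2 | x ∈ triMeshVertices Ω δ ∧ ¬ (3 : ℤ) ∣ x 0 - x 1})
    {x y : Site 2} (hx : meshPoint δ x ∈ V) (hy : meshPoint δ y ∈ V)
    (hx3 : ¬ (3 : ℤ) ∣ x 0 - x 1) (hy3 : ¬ (3 : ℤ) ∣ y 0 - y 1) :
    ∃ (hxN : x ∈ N) (hyN : y ∈ N), ((triMeshGraph Ω δ).induce N).Reachable ⟨x, hxN⟩ ⟨y, hyN⟩ := by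
  classical
  -- perfect hexagons and the punctured domain (no definitions: displayed formulas)
  set HPs : Site 2 → Prop := fun s => ∀ y : Site 2, triGraph.Adj s y → y ∈ triMeshVertices Ω δ ∧
    ∀ y' : Site 2, triGraph.Adj s y' → triGraph.Adj y y' → (triMeshGraph Ω δ).Adj y y' with hHPs
  have hHP : ∀ s : Site 2, HPs s ↔ ∀ y : Site 2, triGraph.Adj s y → y ∈ triMeshVertices Ω δ ∧
      ∀ y' : Site 2, triGraph.Adj s y' → triGraph.Adj y y' → (triMeshGraph Ω δ).Adj y y' :=
    fun s => Iff.rfl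
  set Ωp : Set ℂ := Ω \ triMeshPoint δ ''
    {s : Site 2 | (3 : ℤ) ∣ s 0 - s 1 ∧ s ∈ triMeshVertices Ω δ ∧ ¬ HPs s} with hΩp
  -- balls of radius `ρ - 2δ` about points of `V` lie in the sheared punctured domain
  have hVΩ : ∀ w ∈ V, ball w ρ ⊆ triLinear ⁻¹' Ω := fun w hw =>
    (ball_subset_ball (hVρ w hw).le).trans ball_infDist_compl_subset
  have hVΩp : ∀ w ∈ V, ball w (ρ - 2 * δ) ⊆ triLinear ⁻¹' Ωp := by
    intro w hw z hz
    rw [mem_ball] at hz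
    have hzΩ : z ∈ triLinear ⁻¹' Ω := hVΩ w hw (mem_ball.2 (by linarith))
    refine ⟨hzΩ, ?_⟩
    rintro ⟨s, ⟨-, -, hP⟩, hs⟩
    have hzs : z = meshPoint δ s := triLinear.injective (by rw [triLinear_meshPoint]; exact hs.symm)
    have h1 : infDist (meshPoint δ s) (triLinear ⁻¹' Ω)ᶜ < 3 / 2 * δ :=
      infDist_lt_of_not_hexPerfect hHP hδ hP
    have h2 := infDist_le_infDist_add_dist (s := (triLinear ⁻¹' Ω)ᶜ) (x := w) (y := z)
    have h3 := hVρ w hw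
    rw [dist_comm] at hz
    rw [← hzs] at h1
    linarith
  -- square-mesh reachability in the sheared punctured domain
  obtain ⟨hx', hy', hsq⟩ := meshVertexGraph_reachable_of_mem_bulk (Ω := triLinear ⁻¹' Ωp) hδ
    (by linarith : 3 * δ ≤ ρ - 2 * δ) hV hVΩp hx hy
  -- triangular-mesh reachability in the punctured domain
  have htri : (triMeshVertexGraph Ωp δ).Reachable ⟨x, mem_triMeshVertices_iff_lat.2 hx'⟩
      ⟨y, mem_triMeshVertices_iff_lat.2 hy'⟩ :=
    (hsq.map (meshToLatTriHom (triLinear ⁻¹' Ωp) δ)).map (latTriToTriHom Ωp δ)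
  -- back to `G_N`
  have hxΩ : x ∈ triMeshVertices Ω δ := mem_triMeshVertices_iff_lat.2 (hx'.1)
  have hxN : x ∈ N := by rw [hN]; exact ⟨hxΩ, hx3⟩
  rcases GN_reachable_of_punct_reachable hHP hΩp hN hΩo hΩb hδ hxN htri with ⟨hyN, hr⟩ | ⟨h3, -⟩
  · exact ⟨hxN, hyN, hr⟩
  · exact absurd h3 hy3

/-! ### The largest honeycomb mesh component is the bulk -/

/-- Translating a site by `e₀` moves its mesh point by `δ`. [folklore] -/
theorem dist_meshPoint_add_single (δ : ℝ) (x : Site 2) :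
    dist (meshPoint δ (x + Pi.single 0 1)) (meshPoint δ x) = |δ| := by
  rw [Complex.dist_eq, Complex.norm_def, Complex.normSq_apply, Complex.sub_re, Complex.sub_im,
    meshPoint_re, meshPoint_re, meshPoint_im, meshPoint_im]
  simp only [Pi.add_apply, Pi.single_eq_same, Pi.single_eq_of_ne (show (1 : Fin 2) ≠ 0 by decide),
    add_zero, Int.cast_add, Int.cast_one]
  rw [show (δ * (↑(x 0) + 1) - δ * ↑(x 0)) * (δ * (↑(x 0) + 1) - δ * ↑(x 0)) +
      (δ * ↑(x 1) - δ * ↑(x 1)) * (δ * ↑(x 1) - δ * ↑(x 1)) = δ * δ by ring]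
  exact Real.sqrt_mul_self_eq_abs δ

/-- **The largest honeycomb mesh component is the bulk (every Jordan domain).** For a Jordan
domain `D` (in the embedded coordinates of the fine triangular lattice) and a compact
`K ⊆ D.carrier`, for all small `δ > 0` there is a component `B` of the honeycomb mesh graph
`G_N = (triMeshGraph D.carrier δ).induce N` (`N` the non-centre mesh vertices) containing every
vertex whose mesh point `δ · triEmbed x` lies in `K`, and every other component of `G_N` has
strictly fewer vertices. (Bulk: all non-centre sites at distance `≥ ε/2` from `Ω'ᶜ` are in one
component with `≥ 3 area(Ω')/(8 δ² area B(0,1))` vertices — the non-centre sites and the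
`e₀`-translates of the centre sites at distance `≥ ε` are among them; any other component is
stray, so by `JordanDomain.mul_sub_lt_of_hexStray` its horizontal extent is `< D₀`,
`D₀ = area Ω'/(64 R area B(0,1))`, and it has `≤ 15 D₀ R/δ²` vertices.) [folklore] -/
theorem exists_hexBulk (D : JordanDomain) {K : Set ℂ} (hK : IsCompact K) (hKΩ : K ⊆ D.carrier) :
    ∃ δ₀ > 0, ∀ δ, 0 < δ → δ < δ₀ → ∀ N : Set (Site 2),
      N = {x : Site 2 | x ∈ triMeshVertices D.carrier δ ∧ ¬ (3 : ℤ) ∣ x 0 - x 1} →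
      ∃ B : ((triMeshGraph D.carrier δ).induce N).ConnectedComponent,
        (∀ x : N, triMeshPoint δ (x : Site 2) ∈ K → x ∈ B.supp) ∧
        ∀ C : ((triMeshGraph D.carrier δ).induce N).ConnectedComponent, C ≠ B →
          C.supp.ncard < B.supp.ncard := by
  classical
  set D' := D.triPreimage with hD'
  set Ω := triLinear ⁻¹' D.carrier with hΩ_def
  have hΩo : IsOpen Ω := D'.isOpen
  have hΩb : Bornology.IsBounded Ω := D'.isBounded
  have hΩc : IsConnected Ω := D'.isConnected
  have hΩne : Ω.Nonempty := hΩc.nonempty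
  have hΩuniv : Ω ≠ univ := fun h => NormedSpace.unbounded_univ ℝ ℂ (h ▸ hΩb)
  have hne : Ωᶜ.Nonempty := nonempty_compl.2 hΩuniv
  -- the sheared compact
  set K' : Set ℂ := triLinear ⁻¹' K with hK'
  have hK'c : IsCompact K' := (triLinear.toHomeomorph.isCompact_preimage).2 hK
  have hK'Ω : K' ⊆ Ω := fun z hz => hKΩ hz
  set v : ℝ := volume.real (ball (0 : ℂ) 1) with hv_def
  have hv : 0 < v :=
    ENNReal.toReal_pos (measure_ball_pos volume (0 : ℂ) one_pos).ne' measure_ball_lt_top.ne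
  set m : ℝ := volume.real Ω with hm_def
  have hm : 0 < m := ENNReal.toReal_pos (hΩo.measure_pos volume hΩne).ne' hΩb.measure_lt_top.ne
  -- a radius `R ≥ 1` with `Ω ⊆ B̄(0, R)`
  obtain ⟨R₀, hR₀⟩ := (Metric.isBounded_iff_subset_closedBall (0 : ℂ)).1 hΩb
  set R : ℝ := max R₀ 1 with hR_def
  have hR1 : 1 ≤ R := le_max_right _ _
  have hR : 0 < R := by linarith
  have hΩR : Ω ⊆ closedBall (0 : ℂ) R := hR₀.trans (closedBall_subset_closedBall (le_max_left _ _))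
  -- the horizontal extent allowed to stray components
  set D₀ : ℝ := m / (64 * R * v) with hD₀_def
  have hD₀ : 0 < D₀ := by positivity
  obtain ⟨ε₁, hε₁, δ₁, hδ₁, hnms⟩ := D.mul_sub_lt_of_hexStray hD₀
  -- the collar
  obtain ⟨r₁, hr₁, hT⟩ := exists_pos_volume_real_innerCollar_lt hΩo hΩb hne (by positivity : 0 < m / 4)
  set ε : ℝ := min ε₁ (r₁ / 2) with hε_def
  have hε : 0 < ε := by positivity
  have hεε₁ : ε ≤ ε₁ := min_le_left _ _
  have hεr₁ : 2 * ε ≤ r₁ := by have := min_le_right ε₁ (r₁ / 2); rw [← hε_def] at this; linarith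
  -- the big compact (level `ε / 2`) and the bulk neighbourhood
  set Kbig : Set ℂ := {z | ε / 2 ≤ infDist z Ωᶜ} with hKbig_def
  have hKbigΩ : Kbig ⊆ Ω := fun z hz => by
    by_contra h
    have : infDist z Ωᶜ = 0 := infDist_zero_of_mem h
    have hz' : ε / 2 ≤ infDist z Ωᶜ := hz
    linarith
  have hKbigc : IsCompact Kbig :=
    Metric.isCompact_of_isClosed_isBounded (isClosed_le continuous_const (continuous_infDist_pt _))
      (hΩb.subset hKbigΩ)
  obtain ⟨V, -, hVc, hKV, -, ρ, hρ, hVρ⟩ :=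
    exists_isOpen_isPreconnected_bulk hΩo hΩc hne (hK'c.union hKbigc) (union_subset hK'Ω hKbigΩ)
  -- the threshold
  refine ⟨min (ρ / 5) (min (ε / 2) (min (δ₁ / 2) (D₀ / 2))), by positivity, fun δ hδ hδlt N hN => ?_⟩
  have hδρ : 5 * δ ≤ ρ := by have := hδlt.le.trans (min_le_left _ _); linarith
  have hδε : δ ≤ ε / 2 := hδlt.le.trans ((min_le_right _ _).trans (min_le_left _ _))
  have hδε' : δ ≤ ε := by linarith
  have hδδ₁ : δ < δ₁ := by
    have := hδlt.le.trans ((min_le_right _ _).trans ((min_le_right _ _).trans (min_le_left _ _)))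
    linarith
  have hδD₀ : δ ≤ D₀ := by
    have := hδlt.le.trans ((min_le_right _ _).trans ((min_le_right _ _).trans (min_le_right _ _)))
    linarith
  have hδR : δ ≤ R := by
    have : D₀ ≤ R := by
      rw [hD₀_def, div_le_iff₀ (by positivity)]
      have hmball : m ≤ volume.real (ball (0 : ℂ) (2 * R)) :=
        measureReal_mono (hΩR.trans (closedBall_subset_ball (by linarith)))
          measure_ball_lt_top.ne
      rw [← Measure.addHaar_real_closedBall_eq_addHaar_real_ball volume 0 (2 * R),
        Measure.addHaar_real_closedBall volume _ (by positivity : (0 : ℝ) ≤ 2 * R),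
        Complex.finrank_real_complex] at hmball
      nlinarith [mul_pos hR hv, sq_nonneg R]
    linarith
  set G := (triMeshGraph D.carrier δ).induce N with hG_def
  have hfinV : (triMeshVertices D.carrier δ).Finite := triMeshVertices_finite_holds D.isBounded hδ
  have hNsub : N ⊆ triMeshVertices D.carrier δ := fun x hx => by rw [hN] at hx; exact hx.1
  have hvert : ∀ x : Site 2, meshPoint δ x ∈ Ω → x ∈ triMeshVertices D.carrier δ := fun x hx =>
    mem_triMeshVertices_iff_lat.2 hx
  have hvert' : ∀ x : Site 2, x ∈ triMeshVertices D.carrier δ → meshPoint δ x ∈ Ω := fun x hx =>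
    mem_triMeshVertices_iff_lat.1 hx
  -- the two levels of deep lattice points
  set P : Set (Site 2) := {x | meshPoint δ x ∈ Ω ∧ ε ≤ infDist (meshPoint δ x) Ωᶜ} with hP_def
  set Q : Set (Site 2) := {x | meshPoint δ x ∈ Ω ∧ ε / 2 ≤ infDist (meshPoint δ x) Ωᶜ ∧
    ¬ (3 : ℤ) ∣ x 0 - x 1} with hQ_def
  have hQV : ∀ x ∈ Q, meshPoint δ x ∈ V := fun x hx => hKV (Or.inr hx.2.1)
  -- the lower count: `3m/4 ≤ #P δ² v` and `#P ≤ 2 #Q`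
  have hL := volume_real_le_ncard_mul hΩb hδ hδε'
  have hTmono : volume.real {z ∈ Ω | infDist z Ωᶜ < 2 * ε} ≤
      volume.real {z ∈ Ω | infDist z Ωᶜ < r₁} :=
    measureReal_mono (fun z hz => ⟨hz.1, hz.2.trans_le hεr₁⟩)
      (hΩb.subset fun z hz => hz.1).measure_lt_top.ne
  have hsplit : m ≤ volume.real {z ∈ Ω | 2 * ε ≤ infDist z Ωᶜ} +
      volume.real {z ∈ Ω | infDist z Ωᶜ < 2 * ε} := by
    have hcov : Ω ⊆ {z ∈ Ω | 2 * ε ≤ infDist z Ωᶜ} ∪ {z ∈ Ω | infDist z Ωᶜ < 2 * ε} := by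
      intro z hz
      rcases le_or_gt (2 * ε) (infDist z Ωᶜ) with h | h
      · exact Or.inl ⟨hz, h⟩
      · exact Or.inr ⟨hz, h⟩
    calc m ≤ volume.real ({z ∈ Ω | 2 * ε ≤ infDist z Ωᶜ} ∪ {z ∈ Ω | infDist z Ωᶜ < 2 * ε}) :=
          measureReal_mono hcov ((hΩb.subset (union_subset (fun z hz => hz.1)
            (fun z hz => hz.1))).measure_lt_top.ne)
      _ ≤ _ := measureReal_union_le _ _
  have hPlow : 3 * m / 4 ≤ (P.ncard : ℝ) * (δ ^ 2 * v) := by linarith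
  have hQfin : Q.Finite := (meshVertices_finite hΩb hδ).subset fun x hx => hx.1
  have hPQ : P.ncard ≤ 2 * Q.ncard := by
    -- non-centre points of `P` lie in `Q`; centre points translate by `e₀` into `Q`
    have hsub : P ⊆ {x ∈ P | ¬ (3 : ℤ) ∣ x 0 - x 1} ∪ {x ∈ P | (3 : ℤ) ∣ x 0 - x 1} := by
      intro x hx
      by_cases h3 : (3 : ℤ) ∣ x 0 - x 1
      · exact Or.inr ⟨hx, h3⟩
      · exact Or.inl ⟨hx, h3⟩
    have h1 : {x ∈ P | ¬ (3 : ℤ) ∣ x 0 - x 1} ⊆ Q := fun x hx =>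
      ⟨hx.1.1, by linarith [hx.1.2], hx.2⟩
    have h2 : (fun x : Site 2 => x + Pi.single 0 1) '' {x ∈ P | (3 : ℤ) ∣ x 0 - x 1} ⊆ Q := by
      rintro _ ⟨x, ⟨hxP, h3⟩, rfl⟩
      have hd : dist (meshPoint δ (x + Pi.single 0 1)) (meshPoint δ x) = δ := by
        rw [dist_meshPoint_add_single, abs_of_pos hδ]
      have hball : ball (meshPoint δ x) ε ⊆ Ω :=
        (ball_subset_ball hxP.2).trans ball_infDist_compl_subset
      refine ⟨hball (mem_ball.2 (by linarith)), ?_, ?_⟩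
      · have := infDist_le_infDist_add_dist (s := Ωᶜ) (x := meshPoint δ x)
          (y := meshPoint δ (x + Pi.single 0 1))
        rw [dist_comm] at hd
        linarith [hxP.2]
      · simp only [Pi.add_apply, Pi.single_eq_same,
          Pi.single_eq_of_ne (show (1 : Fin 2) ≠ 0 by decide), add_zero]
        omega
    have hinj : Function.Injective (fun x : Site 2 => x + Pi.single 0 1) := add_left_injective _
    calc P.ncard ≤ ({x ∈ P | ¬ (3 : ℤ) ∣ x 0 - x 1} ∪ {x ∈ P | (3 : ℤ) ∣ x 0 - x 1}).ncard :=
          ncard_le_ncard hsub ((hQfin.subset h1).union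
            ((meshVertices_finite hΩb hδ).subset fun x hx => hx.1.1))
      _ ≤ {x ∈ P | ¬ (3 : ℤ) ∣ x 0 - x 1}.ncard + {x ∈ P | (3 : ℤ) ∣ x 0 - x 1}.ncard :=
          ncard_union_le _ _
      _ ≤ Q.ncard + Q.ncard := by
          refine Nat.add_le_add (ncard_le_ncard h1 hQfin) ?_
          rw [← ncard_image_of_injective _ hinj]
          exact ncard_le_ncard h2 hQfin
      _ = 2 * Q.ncard := by ring
  have hQlow : 3 * m / 8 ≤ (Q.ncard : ℝ) * (δ ^ 2 * v) := by
    have : (P.ncard : ℝ) ≤ 2 * Q.ncard := by exact_mod_cast hPQ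
    nlinarith [show (0 : ℝ) < δ ^ 2 * v by positivity]
  -- the bulk component `B`
  have hQpos : 0 < Q.ncard := Nat.pos_of_ne_zero fun h0 => by
    rw [h0, Nat.cast_zero, zero_mul] at hQlow
    linarith
  obtain ⟨x₀, hx₀⟩ : Q.Nonempty := nonempty_of_ncard_ne_zero (by omega)
  have hx₀N : x₀ ∈ N := by rw [hN]; exact ⟨hvert x₀ hx₀.1, hx₀.2.2⟩
  set B : G.ConnectedComponent := G.connectedComponentMk ⟨x₀, hx₀N⟩ with hB_def
  have hVB : ∀ x, meshPoint δ x ∈ V → ¬ (3 : ℤ) ∣ x 0 - x 1 →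
      ∃ hx : x ∈ N, G.connectedComponentMk ⟨x, hx⟩ = B := by
    intro x hx hx3
    obtain ⟨hxN, _, hr⟩ := GN_reachable_of_mem_bulk D.isOpen D.isBounded hδ hδρ hVc hVρ hN hx
      (hQV x₀ hx₀) hx3 hx₀.2.2
    exact ⟨hxN, SimpleGraph.ConnectedComponent.sound hr⟩
  -- points of any other component are shallow
  have hCbad : ∀ C : G.ConnectedComponent, C ≠ B → ∀ y ∈ C.supp,
      infDist (meshPoint δ (y : Site 2)) Ωᶜ < ε / 2 := by
    rintro C hCB ⟨y, hyN⟩ hyC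
    by_contra hlt
    have hy3 : ¬ (3 : ℤ) ∣ y 0 - y 1 := by rw [hN] at hyN; exact hyN.2
    have hyQ : y ∈ Q := ⟨hvert' y (hNsub hyN), not_lt.1 hlt, hy3⟩
    obtain ⟨hy', hyB⟩ := hVB y (hQV y hyQ) hy3
    rw [SimpleGraph.ConnectedComponent.mem_supp_iff] at hyC
    exact hCB (hyC.symm.trans hyB)
  have hQB : Q ⊆ Subtype.val '' B.supp := fun x hx => by
    obtain ⟨hx', hxB⟩ := hVB x (hQV x hx) hx.2.2
    exact ⟨⟨x, hx'⟩, (SimpleGraph.ConnectedComponent.mem_supp_iff _ _).2 hxB, rfl⟩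
  have hfinB : (Subtype.val '' B.supp).Finite :=
    hfinV.subset (by rintro _ ⟨y, -, rfl⟩; exact hNsub y.2)
  -- stray components are thin: the counting
  set N₁ : ℤ := ⌈D₀ / δ⌉ with hN₁
  set N₂ : ℤ := ⌈R / δ⌉ with hN₂
  have hN₁1 : (N₁ : ℝ) < D₀ / δ + 1 := Int.ceil_lt_add_one _
  have hN₁0 : D₀ / δ ≤ N₁ := Int.le_ceil _
  have hN₂1 : (N₂ : ℝ) < R / δ + 1 := Int.ceil_lt_add_one _
  have hN₂0 : R / δ ≤ N₂ := Int.le_ceil _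
  have hD₀δ : 1 ≤ D₀ / δ := by rw [le_div_iff₀ hδ]; linarith
  have hRδ : 1 ≤ R / δ := by rw [le_div_iff₀ hδ]; linarith
  have hbox : (((Finset.Ioo (0 - N₁) (0 + N₁)) ×ˢ (Finset.Icc (-N₂) N₂)).card : ℝ) <
      3 * m / 8 / (δ ^ 2 * v) := by
    rw [Finset.card_product, Int.card_Ioo, Int.card_Icc, Nat.cast_mul]
    have h1 : (((0 + N₁ - (0 - N₁) - 1).toNat : ℕ) : ℝ) ≤ 2 * (D₀ / δ) + 1 := by
      have hnn : (0 : ℤ) ≤ 0 + N₁ - (0 - N₁) - 1 := by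
        have : (1 : ℝ) ≤ N₁ := hD₀δ.trans hN₁0
        have : (1 : ℤ) ≤ N₁ := by exact_mod_cast this
        omega
      have hc : (((0 + N₁ - (0 - N₁) - 1).toNat : ℕ) : ℝ) = ((0 + N₁ - (0 - N₁) - 1 : ℤ) : ℝ) := by
        rw [← Int.cast_natCast, Int.toNat_of_nonneg hnn]
      rw [hc]; push_cast; linarith
    have h2 : (((N₂ + 1 - -N₂).toNat : ℕ) : ℝ) ≤ 2 * (R / δ) + 3 := by
      have hnn : (0 : ℤ) ≤ N₂ + 1 - -N₂ := by
        have : (1 : ℝ) ≤ N₂ := hRδ.trans hN₂0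
        have : (1 : ℤ) ≤ N₂ := by exact_mod_cast this
        omega
      have hc : (((N₂ + 1 - -N₂).toNat : ℕ) : ℝ) = ((N₂ + 1 - -N₂ : ℤ) : ℝ) := by
        rw [← Int.cast_natCast, Int.toNat_of_nonneg hnn]
      rw [hc]; push_cast; linarith
    have h3 : (2 * (D₀ / δ) + 1) * (2 * (R / δ) + 3) ≤ 15 * (D₀ / δ) * (R / δ) := by nlinarith
    have h4 : 15 * (D₀ / δ) * (R / δ) < 3 * m / 8 / (δ ^ 2 * v) := by
      rw [hD₀_def, lt_div_iff₀ (by positivity)]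
      have : 15 * (m / (64 * R * v) / δ) * (R / δ) * (δ ^ 2 * v) = 15 * m / 64 := by
        field_simp
      rw [this]
      linarith
    exact (mul_le_mul h1 h2 (by positivity) (by positivity)).trans_lt (h3.trans_lt h4)
  have hcardC : ∀ C : G.ConnectedComponent, C ≠ B → C.supp.ncard < B.supp.ncard := by
    intro C hCB
    rw [← ncard_image_of_injective C.supp Subtype.val_injective,
      ← ncard_image_of_injective B.supp Subtype.val_injective]
    -- a base point of `C`
    obtain ⟨xc, hxc⟩ : C.supp.Nonempty := by
      induction C using SimpleGraph.ConnectedComponent.ind with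
      | h w => exact ⟨w, rfl⟩
    have hstray : ∀ z : N, G.Reachable xc z →
        infDist (meshPoint δ (z : Site 2)) Ωᶜ < ε₁ := by
      intro z hz
      refine (hCbad C hCB z ?_).trans_le (by linarith)
      rw [SimpleGraph.ConnectedComponent.mem_supp_iff] at hxc ⊢
      rw [← hxc]
      exact SimpleGraph.ConnectedComponent.sound hz.symm
    have hcoord : ∀ y ∈ Subtype.val '' C.supp, |y 0 - (xc : Site 2) 0| < N₁ ∧ |y 1| ≤ N₂ := by
      rintro _ ⟨y, hyC, rfl⟩
      have hreach : G.Reachable xc y := by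
        rw [SimpleGraph.ConnectedComponent.mem_supp_iff] at hxc hyC
        exact SimpleGraph.ConnectedComponent.exact (hxc.trans hyC.symm)
      have h1 := hnms δ hδ hδδ₁ N hN xc y hreach hstray
      have hstray' : ∀ z : N, G.Reachable y z →
          infDist (meshPoint δ (z : Site 2)) Ωᶜ < ε₁ := fun z hz => hstray z (hreach.trans hz)
      have h2 := hnms δ hδ hδδ₁ N hN y xc hreach.symm hstray'
      constructor
      · have ha : ((y : Site 2) 0 : ℝ) - (xc : Site 2) 0 < N₁ := by
          have : δ * (((y : Site 2) 0 : ℝ) - (xc : Site 2) 0) < δ * N₁ := by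
            calc δ * (((y : Site 2) 0 : ℝ) - (xc : Site 2) 0) < D₀ := h1
              _ = δ * (D₀ / δ) := by field_simp
              _ ≤ δ * N₁ := mul_le_mul_of_nonneg_left hN₁0 hδ.le
          exact lt_of_mul_lt_mul_left this hδ.le
        have hb : ((xc : Site 2) 0 : ℝ) - (y : Site 2) 0 < N₁ := by
          have : δ * (((xc : Site 2) 0 : ℝ) - (y : Site 2) 0) < δ * N₁ := by
            calc δ * (((xc : Site 2) 0 : ℝ) - (y : Site 2) 0) < D₀ := h2
              _ = δ * (D₀ / δ) := by field_simp
              _ ≤ δ * N₁ := mul_le_mul_of_nonneg_left hN₁0 hδ.le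
          exact lt_of_mul_lt_mul_left this hδ.le
        have ha' : (y : Site 2) 0 - (xc : Site 2) 0 < N₁ := by exact_mod_cast ha
        have hb' : (xc : Site 2) 0 - (y : Site 2) 0 < N₁ := by exact_mod_cast hb
        rw [abs_lt]; omega
      · have hyΩ : meshPoint δ (y : Site 2) ∈ closedBall (0 : ℂ) R := hΩR (hvert' _ (hNsub y.2))
        rw [mem_closedBall, dist_zero_right] at hyΩ
        have him := (Complex.abs_im_le_norm _).trans hyΩ
        rw [meshPoint_im, abs_mul, abs_of_pos hδ] at him
        have : (|((y : Site 2) 1 : ℝ)|) ≤ N₂ := by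
          have : (|((y : Site 2) 1 : ℝ)|) ≤ R / δ := by rw [le_div_iff₀ hδ]; linarith
          exact this.trans hN₂0
        have : ((|(y : Site 2) 1| : ℤ) : ℝ) ≤ N₂ := by push_cast; exact this
        exact_mod_cast this
    have hC := JordanDomain.ncard_le_of_coord_bounds hcoord
    have hC' : ((Subtype.val '' C.supp).ncard : ℝ) < 3 * m / 8 / (δ ^ 2 * v) := by
      refine lt_of_le_of_lt ?_ hbox
      have : ((Finset.Ioo ((xc : Site 2) 0 - N₁) ((xc : Site 2) 0 + N₁)) ×ˢ (Finset.Icc (-N₂) N₂)).card =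
          ((Finset.Ioo (0 - N₁) (0 + N₁)) ×ˢ (Finset.Icc (-N₂) N₂)).card := by
        rw [Finset.card_product, Finset.card_product, Int.card_Ioo, Int.card_Ioo]
        congr 2; omega
      rw [← this]
      exact_mod_cast hC
    have hQ' : 3 * m / 8 / (δ ^ 2 * v) ≤ (Q.ncard : ℝ) := by
      rw [div_le_iff₀ (by positivity)]; exact hQlow
    have : ((Subtype.val '' C.supp).ncard : ℝ) < (Subtype.val '' B.supp).ncard := by
      calc ((Subtype.val '' C.supp).ncard : ℝ) < Q.ncard := hC'.trans_le hQ'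
        _ ≤ (Subtype.val '' B.supp).ncard := by exact_mod_cast ncard_le_ncard hQB hfinB
    exact_mod_cast this
  refine ⟨B, fun x hxK => ?_, hcardC⟩
  have hxK' : meshPoint δ (x : Site 2) ∈ K' := by
    show triLinear (meshPoint δ (x : Site 2)) ∈ K
    rwa [triLinear_meshPoint]
  have hx3 : ¬ (3 : ℤ) ∣ (x : Site 2) 0 - (x : Site 2) 1 := not_dvd_of_mem_N hN x.2
  obtain ⟨hx', hxB⟩ := hVB x (hKV (Or.inl hxK')) hx3
  rw [SimpleGraph.ConnectedComponent.mem_supp_iff, ← hxB]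

end Summit.CriticalPhenomena.SAWScalingLimit.Theorems.HexEndpointApprox
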